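import Summits.BirchSwinnertonDyer.BirchSwinnertonDyer.Theorems.ByReductionTypeAtTwoAdditivePotMultConjATwoNarrowTwo6728Dyadic
import Summits.BirchSwinnertonDyer.BirchSwinnertonDyer.Theorems.ByReductionTypeAtTwoFineSelmerConjAAtTwoAdditivePotGoodNarrowRankCertificate316LayerTwoParity
import HarnessLib

/-!
# C4″ `AdditivePotMultOverKAtTwo` (item stmt-BirchSwinnertonDyer-22618), the (I1M′) input of the upper half on the `0 < Δ` rows:
# LAYER-TWO NARROW CERTIFICATE `d = 6728` (S₃-CLOSURE ROAD), part PARITY-ONE — `h(A₁)` is ODD for `A₁ = ℚ(θ) ⊔ ℚ_1 = E(√2)`: the quadratic extension `A₁/E`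
# is ramified at exactly ONE prime (`𝔭`; `𝔮` splits as `(π₂)(π₃)`), so genus theory needs no unit (KERNEL; rows 121104ct1, 336400cb1)

Cell `bsd-2adic`, rung K4, seat `bsd-2adic-k4-w3` GEN 15 (explicit unit of director-bsd g16 (309)(7); `--supports stmt-BirchSwinnertonDyer-22618`).
HONEST FRAMING (D-0036/D-0054/D-0152): THEOREMS ONLY (no definition, no named fact, no `sorry`, no instance). The series `…NarrowTwo6728{Class, Field,
Dyadic, ParityOne, TotPos, Integers, Parity, SignsW…, Units, Row…}` is the S₃-CLOSURE ROAD of the layer-two narrow certificate: the totally real cubic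
`2`-torsion field `E` of discriminant `6728 = 8·m²` (`X³ + (0)X² + (-29)X + (58)`) has Galois closure `A₁ = E(√2) = ℚ(θ) ⊔ ℚ_1` (group `S₃`), so
`2 = (π₁π₂π₃)²` in `A₁` (three dyadic primes, `e = 2`, `f = 1`), `A₁/E` is ramified at ONE prime (⇒ `h(A₁)` odd with no unit condition) and
`A₂/A₁` (`A₂ = ℚ(θ) ⊔ ℚ_2 = E(√(2+√2))`) at THREE (⇒ `h(A₂)` odd from TWO independent dyadic non-norm units); `#(U⁺/U²)(A₁) ≥ 4` from two
totally positive units with three residue witnesses (ring maps `𝓞 A₁ → 𝓞 A₂ → 𝔽_ℓ`, k4-w2's `exists_ringHom_ringOfIntegers_sup_layer_two_zmod`),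
TEN sign-independent units of `A₂` (with `−1`), k4-w2's Edgar–Mollin–Peterson door with `a = 2`, `b = 10`
(`[Cl⁺(A₂):Cl⁺(A₂)²] = [Cl⁺(A₁):Cl⁺(A₁)²] = 4`), and cruxlead-19573-w2's rung `m = 1`; C4″ census rows 121104ct1, 336400cb1 (eng-2 CERT-ADD-POTMULT-POS81-AB-E2:
`rank₂ Cl⁺ = [1,2,2]`, `h = 1` at layers `0,1,2`, `n₀ = 1` — letter NARROW-EQUAL12, instrument grade `grh`; here KERNEL).
All certificates were found by the seat's exact-arithmetic tools (`k4w3/gen15/tools`: `s3explore`, `certs3`, GEN 13/14 `nf12/unitlib`) and are CHECKED HERE by the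
kernel. Statement (A) is NOT BSD: BSD₂ for these curves is not proved; C4″ / (I1M′) stay research-open; nothing booked; no row of 22618 changes tier
(pen RC-490 (4)); BSD is not proved by any of this.

References: [CoatesSujatha2005] Conj. A, Thm. 3.4; [Fukuda1994] Thm. 1 (2); [EdgarMollinPeterson1986] Thm. 2.1; [FrohlichTaylor1990] Ch. V §1 (1.8)–(1.13);
[Lang1990] Ch. 13 §4 Lemma 4.1; [Washington1997] §13.1, Prop. 13.2; [Cohen1993] §4.1.3, §6.3; [Marcus1977] Ch. 3 Thm. 27, Ch. 5 Thm. 22; [Omeara1963] §63.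
-/

set_option autoImplicit false
-- sibling precedent: the directory name repeats the summit name
set_option linter.dupNamespace false

noncomputable section

open scoped Classical IntermediateField NumberField nonZeroDivisors Polynomial

namespace Summit.BirchSwinnertonDyer.BirchSwinnertonDyer.Theorems.AddKatoTwo

open Polynomial IsDedekindDomain NumberField Field IntermediateField
  Literature.NumberTheory.EllipticCurves Literature.NumberTheory.EllipticCurves.ZpExtension
  Literature.NumberTheory.IwasawaTheory Literature.NumberTheory.NumberFields
  Literature.NumberTheory.GaloisRepresentations Literature.Geometry.Kaehler.ComplexTorus

variable {θ : AlgebraicClosure ℚ}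

set_option linter.unusedSimpArgs false in
set_option maxHeartbeats 3200000 in
/-- **`h(ℚ(θ) ⊔ ℚ_1)` is ODD for `θ³ + (0)θ² + (-29)θ + (58) = 0`** (`A₁ = ℚ(θ, √2) = E(√2)`, the `S₃` Galois closure of the cubic field of discriminant `6728 = 8m²`):
genus theory for `A₁/E` with NO unit condition — exactly ONE prime of `E` ramifies: the primes above `2` are `𝔭 = (26 - 2 * θ - θ ^ 2)` and `𝔮 = (-3 + θ)`
(`2 = u·π_𝔭·π_𝔮²`), a prime not above `2` is unramified (`A₁ = E(√2)`, tree `isUnramifiedAt_of_sq_eq`), and `𝔮` is unramified: `π_𝔮 = v₂·π₂·π₃` with `π₂ ∤ π₃`,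
so `e((π₂) | 𝔮) = 1` (`Ideal.ramificationIdx'_spec`); `h(E)` odd (`odd_classNumber_adjoin_d6728p`) and the tree door
`AmbiguousClass.odd_classNumber_of_quadratic_of_isTotallyReal_of_prod_ramificationIdxIn_dvd_two`. KERNEL. [cite: Lang1990, Ch. 13 §4, Lemma 4.1 (PDF pp. 203–204)]
[cite: Gras2003, IV.4 (genus theory)] [cite: NeukirchANT1999, Ch. III (2.6)] -/
theorem odd_classNumber_adjoin_sup_layer_one_d6728 (hθ : aeval θ (Cubic.toPoly ⟨1, ((0 : ℤ) : ℚ), ((-29 : ℤ) : ℚ), ((58 : ℤ) : ℚ)⟩) = 0) :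
    haveI : FiniteDimensional ℚ ↥ℚ⟮θ⟯ :=
      IntermediateField.adjoin.finiteDimensional ⟨_, Cubic.monic_of_a_eq_one', by rwa [← aeval_def]⟩
    haveI : FiniteDimensional ℚ ↥((CyclotomicZp.zpExtension 2).layer 1) := (CyclotomicZp.zpExtension 2).finiteDimensional_layer_holds 1
    haveI : NumberField ↥(ℚ⟮θ⟯ ⊔ (CyclotomicZp.zpExtension 2).layer 1) := NumberField.mk
    Odd (classNumber ↥(ℚ⟮θ⟯ ⊔ (CyclotomicZp.zpExtension 2).layer 1)) := by
  haveI : FiniteDimensional ℚ ↥ℚ⟮θ⟯ :=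
    IntermediateField.adjoin.finiteDimensional ⟨_, Cubic.monic_of_a_eq_one', by rwa [← aeval_def]⟩
  haveI : FiniteDimensional ℚ ↥((CyclotomicZp.zpExtension 2).layer 1) := (CyclotomicZp.zpExtension 2).finiteDimensional_layer_holds 1
  haveI : NumberField ↥ℚ⟮θ⟯ := NumberField.mk
  haveI : NumberField ↥(ℚ⟮θ⟯ ⊔ (CyclotomicZp.zpExtension 2).layer 1) := NumberField.mk
  classical
  obtain ⟨hrealA, hfinA, h3⟩ := layer_one_basics irreducible_cubic_d6728p hθ (isTotallyReal_adjoin_d6728p hθ)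
  haveI := hrealA
  -- `t = e² − 2 ∈ ℚ_1` with `t² = 2`
  obtain ⟨e, he, -, he4⟩ := CyclotomicZp.exists_mem_layer_two_quartic_zpExtension
  have he0 : (fun x : AlgebraicClosure ℚ => x ^ 2 - 2)^[2] e = 0 := by
    simp only [Function.iterate_succ, Function.iterate_zero, Function.comp_apply, id_eq]
    linear_combination he4
  obtain ⟨ht, ht2⟩ := sq_sub_two_mem_layer_one_d316 he0
  have hKA : ℚ⟮θ⟯ ≤ ℚ⟮θ⟯ ⊔ (CyclotomicZp.zpExtension 2).layer 1 := le_sup_left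
  letI : Algebra ↥ℚ⟮θ⟯ ↥(ℚ⟮θ⟯ ⊔ (CyclotomicZp.zpExtension 2).layer 1) := (inclusion hKA).toRingHom.toAlgebra
  have halg : ∀ c : ↥ℚ⟮θ⟯, algebraMap ↥ℚ⟮θ⟯ ↥(ℚ⟮θ⟯ ⊔ (CyclotomicZp.zpExtension 2).layer 1) c = inclusion hKA c := fun _ => rfl
  haveI : IsScalarTower ℚ ↥ℚ⟮θ⟯ ↥(ℚ⟮θ⟯ ⊔ (CyclotomicZp.zpExtension 2).layer 1) :=
    IsScalarTower.of_algebraMap_eq fun q => ((inclusion hKA).commutes q).symm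
  haveI : Module.Finite ↥ℚ⟮θ⟯ ↥(ℚ⟮θ⟯ ⊔ (CyclotomicZp.zpExtension 2).layer 1) := Module.Finite.of_restrictScalars_finite ℚ ↥ℚ⟮θ⟯ _
  have hdeg : Module.finrank ↥ℚ⟮θ⟯ ↥(ℚ⟮θ⟯ ⊔ (CyclotomicZp.zpExtension 2).layer 1) = 2 := by
    have htower := Module.finrank_mul_finrank ℚ ↥ℚ⟮θ⟯ ↥(ℚ⟮θ⟯ ⊔ (CyclotomicZp.zpExtension 2).layer 1)
    rw [h3, hfinA] at htower
    omega
  haveI : Algebra.IsQuadraticExtension ↥ℚ⟮θ⟯ ↥(ℚ⟮θ⟯ ⊔ (CyclotomicZp.zpExtension 2).layer 1) := ⟨hdeg⟩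
  haveI : IsGalois ↥ℚ⟮θ⟯ ↥(ℚ⟮θ⟯ ⊔ (CyclotomicZp.zpExtension 2).layer 1) := inferInstance
  -- dyadic data of `A₁`
  obtain ⟨bA, xA, sA, hbAval, hsAval, -, RbA, RxA, hs, hsA2, ⟨hprime1, -, -, -, hP1⟩, ⟨hprime2, -, -, -, hP2⟩, ⟨hprime3, -, -, -, hP3⟩⟩ :=
    layer_one_dyadic_d6728 hθ ht ht2
  obtain ⟨-, -, -, -, -, -, -, -, -, -, -, -, -, -, -, -, hpiqf, -, hv2inv, hg23, -⟩ := layer_one_ids_d6728 bA xA RbA RxA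
  have hsK : (sA : ↥(ℚ⟮θ⟯ ⊔ (CyclotomicZp.zpExtension 2).layer 1)) ∉ Set.range (algebraMap ↥ℚ⟮θ⟯ ↥(ℚ⟮θ⟯ ⊔ (CyclotomicZp.zpExtension 2).layer 1)) := by
    rw [hsAval]; exact sqrt_two_not_mem_range irreducible_cubic_d6728p hθ (isTotallyReal_adjoin_d6728p hθ) ht ht2
  -- `b = θ ∈ 𝓞 E`, `algebraMap b = bA`
  obtain ⟨b, hbθ, hb⟩ := exists_ringOfIntegers_cubic_root (p := 0) (q := -29) (r := 58) hθ
  have hb' : 58 - 29 * b + b ^ 3 = 0 := by push_cast at hb; linear_combination hb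
  have hbgen : algebraMap (𝓞 ↥ℚ⟮θ⟯) ↥ℚ⟮θ⟯ b = AdjoinSimple.gen ℚ θ := Subtype.ext hbθ
  have hbmap : algebraMap (𝓞 ↥ℚ⟮θ⟯) (𝓞 ↥(ℚ⟮θ⟯ ⊔ (CyclotomicZp.zpExtension 2).layer 1)) b = bA := by
    apply NumberField.RingOfIntegers.coe_injective
    show ((algebraMap (𝓞 ↥ℚ⟮θ⟯) (𝓞 ↥(ℚ⟮θ⟯ ⊔ (CyclotomicZp.zpExtension 2).layer 1)) b : 𝓞 ↥(ℚ⟮θ⟯ ⊔ (CyclotomicZp.zpExtension 2).layer 1)) : ↥(ℚ⟮θ⟯ ⊔ (CyclotomicZp.zpExtension 2).layer 1)) = (bA : ↥(ℚ⟮θ⟯ ⊔ (CyclotomicZp.zpExtension 2).layer 1))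
    rw [hbAval, NumberField.RingOfIntegers.coe_eq_algebraMap, ← IsScalarTower.algebraMap_apply,
      IsScalarTower.algebraMap_apply (𝓞 ↥ℚ⟮θ⟯) ↥ℚ⟮θ⟯ ↥(ℚ⟮θ⟯ ⊔ (CyclotomicZp.zpExtension 2).layer 1), hbgen, halg]
  -- the primes `𝔭 = (π_𝔭)`, `𝔮 = (π_𝔮)` of `E` above `2`
  have h2E : (2 : 𝓞 ↥ℚ⟮θ⟯) = (1) * (26 - 2 * b - b ^ 2) * (-3 + b) ^ 2 := by linear_combination ((-4 : 𝓞 ↥ℚ⟮θ⟯) + (1 : 𝓞 ↥ℚ⟮θ⟯) * b) * hb'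
  have hUE : IsUnit ((1) : 𝓞 ↥ℚ⟮θ⟯) := IsUnit.of_mul_eq_one ((1) : 𝓞 ↥ℚ⟮θ⟯) (by linear_combination ((0 : 𝓞 ↥ℚ⟮θ⟯)) * hb')
  have hNp : (Algebra.norm ℤ ((26 - 2 * b - b ^ 2) : 𝓞 ↥ℚ⟮θ⟯)).natAbs = 2 := by
    have h := natAbs_norm_coords_eq_natAbs_normPoly ↥ℚ⟮θ⟯ h3 b (p := 0) (q := -29) (r := 58) irreducible_cubic_d6728p hb (26) (-2) (-1)
    have he : (((26 : ℤ) : 𝓞 ↥ℚ⟮θ⟯) + ((-2 : ℤ) : 𝓞 ↥ℚ⟮θ⟯) * b + ((-1 : ℤ) : 𝓞 ↥ℚ⟮θ⟯) * b ^ 2) = 26 - 2 * b - b ^ 2 := by push_cast; ring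
    rw [he] at h; rw [h]; norm_num
  have hNq : (Algebra.norm ℤ ((-3 + b) : 𝓞 ↥ℚ⟮θ⟯)).natAbs = 2 := by
    have h := natAbs_norm_coords_eq_natAbs_normPoly ↥ℚ⟮θ⟯ h3 b (p := 0) (q := -29) (r := 58) irreducible_cubic_d6728p hb (-3) (1) (0)
    have he : (((-3 : ℤ) : 𝓞 ↥ℚ⟮θ⟯) + ((1 : ℤ) : 𝓞 ↥ℚ⟮θ⟯) * b + ((0 : ℤ) : 𝓞 ↥ℚ⟮θ⟯) * b ^ 2) = -3 + b := by push_cast; ring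
    rw [he] at h; rw [h]; norm_num
  have hPp : (Ideal.span {((26 - 2 * b - b ^ 2) : 𝓞 ↥ℚ⟮θ⟯)}).IsPrime :=
    Ideal.isPrime_of_irreducible_absNorm (by rw [Ideal.absNorm_span_singleton, hNp]; exact Nat.prime_two)
  have hPq : (Ideal.span {((-3 + b) : 𝓞 ↥ℚ⟮θ⟯)}).IsPrime :=
    Ideal.isPrime_of_irreducible_absNorm (by rw [Ideal.absNorm_span_singleton, hNq]; exact Nat.prime_two)
  have hp0 : Ideal.span {((26 - 2 * b - b ^ 2) : 𝓞 ↥ℚ⟮θ⟯)} ≠ ⊥ := by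
    rw [Ne, Ideal.span_singleton_eq_bot]; intro h0; rw [h0, Algebra.norm_zero] at hNp; norm_num at hNp
  have hq0 : Ideal.span {((-3 + b) : 𝓞 ↥ℚ⟮θ⟯)} ≠ ⊥ := by
    rw [Ne, Ideal.span_singleton_eq_bot]; intro h0; rw [h0, Algebra.norm_zero] at hNq; norm_num at hNq
  set wp : HeightOneSpectrum (𝓞 ↥ℚ⟮θ⟯) := ⟨Ideal.span {((26 - 2 * b - b ^ 2) : 𝓞 ↥ℚ⟮θ⟯)}, hPp, hp0⟩ with hwp
  -- `A₁ = E(t')`, `sA² = 2`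
  have hsA2' : sA ^ 2 = algebraMap (𝓞 ↥ℚ⟮θ⟯) (𝓞 ↥(ℚ⟮θ⟯ ⊔ (CyclotomicZp.zpExtension 2).layer 1)) 2 := by rw [hsA2, map_ofNat]
  have htint : IsIntegral ↥ℚ⟮θ⟯ (sA : ↥(ℚ⟮θ⟯ ⊔ (CyclotomicZp.zpExtension 2).layer 1)) := (Algebra.IsIntegral.isIntegral (R := ℚ) (sA : ↥(ℚ⟮θ⟯ ⊔ (CyclotomicZp.zpExtension 2).layer 1))).tower_top
  have hgen : IntermediateField.adjoin ↥ℚ⟮θ⟯ ({(sA : ↥(ℚ⟮θ⟯ ⊔ (CyclotomicZp.zpExtension 2).layer 1))} : Set ↥(ℚ⟮θ⟯ ⊔ (CyclotomicZp.zpExtension 2).layer 1)) = ⊤ := by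
    have h2le : 2 ≤ (minpoly ↥ℚ⟮θ⟯ (sA : ↥(ℚ⟮θ⟯ ⊔ (CyclotomicZp.zpExtension 2).layer 1))).natDegree := (minpoly.two_le_natDegree_iff htint).mpr hsK
    refine IntermediateField.eq_of_le_of_finrank_eq le_top ?_
    rw [IntermediateField.adjoin.finrank htint, IntermediateField.finrank_top', hdeg]
    exact le_antisymm ((minpoly.natDegree_le (A := ↥ℚ⟮θ⟯) (x := (sA : ↥(ℚ⟮θ⟯ ⊔ (CyclotomicZp.zpExtension 2).layer 1)))).trans hdeg.le) h2le
  have hgenA : Algebra.adjoin ↥ℚ⟮θ⟯ ({(sA : ↥(ℚ⟮θ⟯ ⊔ (CyclotomicZp.zpExtension 2).layer 1))} : Set ↥(ℚ⟮θ⟯ ⊔ (CyclotomicZp.zpExtension 2).layer 1)) = ⊤ := by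
    rw [← IntermediateField.adjoin_simple_toSubalgebra_of_isAlgebraic htint.isAlgebraic, hgen, IntermediateField.top_toSubalgebra]
  -- at most the prime `𝔭` ramifies in `A₁/E`
  have hram : (∏ᶠ v : HeightOneSpectrum (𝓞 ↥ℚ⟮θ⟯), v.asIdeal.ramificationIdxIn (𝓞 ↥(ℚ⟮θ⟯ ⊔ (CyclotomicZp.zpExtension 2).layer 1))) ∣ 2 := by
    rw [AmbiguousClass.finprod_ramificationIdxIn_eq_pow_of_prime Nat.prime_two hdeg]
    have hsub : {v : HeightOneSpectrum (𝓞 ↥ℚ⟮θ⟯) | v.asIdeal.ramificationIdxIn (𝓞 ↥(ℚ⟮θ⟯ ⊔ (CyclotomicZp.zpExtension 2).layer 1)) ≠ 1} ⊆ {wp} := by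
      intro v hv
      rw [Set.mem_setOf_eq] at hv
      haveI := v.isMaximal
      -- `2 ∈ v`
      have h2v : (2 : 𝓞 ↥ℚ⟮θ⟯) ∈ v.asIdeal := by
        by_contra h2
        apply hv
        obtain ⟨Q, hQmax, hQover⟩ := Ideal.exists_maximal_ideal_liesOver_of_isIntegral (S := 𝓞 ↥(ℚ⟮θ⟯ ⊔ (CyclotomicZp.zpExtension 2).layer 1)) v.asIdeal
        haveI := hQmax
        haveI := hQover
        rw [Ideal.ramificationIdxIn_eq_ramificationIdx v.asIdeal Q (↥(ℚ⟮θ⟯ ⊔ (CyclotomicZp.zpExtension 2).layer 1) ≃ₐ[↥ℚ⟮θ⟯] ↥(ℚ⟮θ⟯ ⊔ (CyclotomicZp.zpExtension 2).layer 1))]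
        have hunr : Algebra.IsUnramifiedAt (𝓞 ↥ℚ⟮θ⟯) Q := by
          refine isUnramifiedAt_of_sq_eq hsA2' hgenA Q fun hmem => h2 ?_
          have hu : (4 * 2 : 𝓞 ↥ℚ⟮θ⟯) ∈ Q.under (𝓞 ↥ℚ⟮θ⟯) := by
            rw [Ideal.under_def, Ideal.mem_comap]; exact hmem
          rw [← Ideal.over_def Q v.asIdeal] at hu
          rcases v.isPrime.mem_or_mem hu with h | h
          · have h22 : (4 : 𝓞 ↥ℚ⟮θ⟯) = 2 * 2 := by norm_num
            rw [h22] at h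
            exact (v.isPrime.mem_or_mem h).elim id id
          · exact h
        exact Ideal.ramificationIdx_eq_one_iff.mpr hunr
      -- `π_𝔭 ∈ v ∨ π_𝔮 ∈ v`
      rw [h2E] at h2v
      have hπ : ((26 - 2 * b - b ^ 2) : 𝓞 ↥ℚ⟮θ⟯) ∈ v.asIdeal ∨ ((-3 + b) : 𝓞 ↥ℚ⟮θ⟯) ∈ v.asIdeal := by
        rcases v.isPrime.mem_or_mem h2v with h | h
        · rcases v.isPrime.mem_or_mem h with hu | hp
          · exact absurd (Ideal.eq_top_of_isUnit_mem _ hu hUE) v.isPrime.ne_top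
          · exact Or.inl hp
        · exact Or.inr (v.isPrime.mem_of_pow_mem 2 h)
      simp only [Set.mem_singleton_iff]
      rcases hπ with h | h
      · apply HeightOneSpectrum.ext
        exact ((hPp.isMaximal hp0).eq_of_le v.isPrime.ne_top ((Ideal.span_singleton_le_iff_mem _).mpr h)).symm
      · -- `v = 𝔮` is unramified: `π_𝔮 = v₂ π₂ π₃`, `π₂ ∤ π₃`
        exfalso; apply hv
        have hvq : v.asIdeal = Ideal.span {((-3 + b) : 𝓞 ↥ℚ⟮θ⟯)} :=
          ((hPq.isMaximal hq0).eq_of_le v.isPrime.ne_top ((Ideal.span_singleton_le_iff_mem _).mpr h)).symm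
        set Q : Ideal (𝓞 ↥(ℚ⟮θ⟯ ⊔ (CyclotomicZp.zpExtension 2).layer 1)) := Ideal.span {(-31 - 194 * xA + 7 * bA + 43 * bA * xA + 2 * bA ^ 2 + 12 * bA ^ 2 * xA : 𝓞 ↥(ℚ⟮θ⟯ ⊔ (CyclotomicZp.zpExtension 2).layer 1))} with hQ
        haveI hQp : Q.IsPrime := hP2
        have hmapq : algebraMap (𝓞 ↥ℚ⟮θ⟯) (𝓞 ↥(ℚ⟮θ⟯ ⊔ (CyclotomicZp.zpExtension 2).layer 1)) (-3 + b) = (-1) * (-31 - 194 * xA + 7 * bA + 43 * bA * xA + 2 * bA ^ 2 + 12 * bA ^ 2 * xA) * (31 + 194 * xA - 8 * bA - 43 * bA * xA - 2 * bA ^ 2 - 12 * bA ^ 2 * xA) := by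
          simp only [map_add, map_sub, map_mul, map_pow, map_ofNat, map_neg, map_one, hbmap]; exact hpiqf
        have hunder : Q.under (𝓞 ↥ℚ⟮θ⟯) = v.asIdeal := by
          rw [hvq]
          refine ((hPq.isMaximal hq0).eq_of_le (Ideal.comap_ne_top _ hQp.ne_top) ?_).symm
          rw [Ideal.span_singleton_le_iff_mem]
          show ((-3 + b) : 𝓞 ↥ℚ⟮θ⟯) ∈ Ideal.comap (algebraMap (𝓞 ↥ℚ⟮θ⟯) (𝓞 ↥(ℚ⟮θ⟯ ⊔ (CyclotomicZp.zpExtension 2).layer 1))) Q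
          rw [Ideal.mem_comap, hmapq, hQ]
          exact Ideal.mem_span_singleton.mpr ⟨(-1) * (31 + 194 * xA - 8 * bA - 43 * bA * xA - 2 * bA ^ 2 - 12 * bA ^ 2 * xA), by ring⟩
        haveI hQover : Q.LiesOver v.asIdeal := ⟨hunder.symm⟩
        rw [Ideal.ramificationIdxIn_eq_ramificationIdx v.asIdeal Q (↥(ℚ⟮θ⟯ ⊔ (CyclotomicZp.zpExtension 2).layer 1) ≃ₐ[↥ℚ⟮θ⟯] ↥(ℚ⟮θ⟯ ⊔ (CyclotomicZp.zpExtension 2).layer 1))]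
        have hmap : Ideal.map (algebraMap (𝓞 ↥ℚ⟮θ⟯) (𝓞 ↥(ℚ⟮θ⟯ ⊔ (CyclotomicZp.zpExtension 2).layer 1))) v.asIdeal = Ideal.span {(-1) * (-31 - 194 * xA + 7 * bA + 43 * bA * xA + 2 * bA ^ 2 + 12 * bA ^ 2 * xA) * (31 + 194 * xA - 8 * bA - 43 * bA * xA - 2 * bA ^ 2 - 12 * bA ^ 2 * xA)} := by
          rw [hvq, Ideal.map_span, Set.image_singleton, hmapq]
        have hne : Ideal.map (algebraMap (𝓞 ↥ℚ⟮θ⟯) (𝓞 ↥(ℚ⟮θ⟯ ⊔ (CyclotomicZp.zpExtension 2).layer 1))) v.asIdeal ≠ ⊥ := by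
          rw [hmap, Ne, Ideal.span_singleton_eq_bot]
          exact mul_ne_zero (mul_ne_zero (IsUnit.of_mul_eq_one _ hv2inv).ne_zero hprime2.ne_zero) hprime3.ne_zero
        rw [← Ideal.ramificationIdx'_eq_ramificationIdx' v.asIdeal Q hne]
        apply Ideal.ramificationIdx'_spec
        · rw [pow_one, hmap, hQ, Ideal.span_singleton_le_span_singleton]
          exact ⟨(-1) * (31 + 194 * xA - 8 * bA - 43 * bA * xA - 2 * bA ^ 2 - 12 * bA ^ 2 * xA), by ring⟩
        · rw [hmap, hQ, Ideal.span_singleton_pow, Ideal.span_singleton_le_span_singleton]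
          rintro ⟨c, hc⟩
          have hc' : (-1) * (31 + 194 * xA - 8 * bA - 43 * bA * xA - 2 * bA ^ 2 - 12 * bA ^ 2 * xA) = (-31 - 194 * xA + 7 * bA + 43 * bA * xA + 2 * bA ^ 2 + 12 * bA ^ 2 * xA) * c :=
            mul_left_cancel₀ hprime2.ne_zero (by linear_combination hc)
          rcases hprime2.dvd_or_dvd ⟨c, hc'⟩ with hd | hd
          · exact hprime2.not_unit (isUnit_of_dvd_unit hd (IsUnit.of_mul_eq_one _ hv2inv))
          · obtain ⟨c', hc''⟩ := hd
            exact hprime2.not_unit (isUnit_of_dvd_one ⟨c' - (414 + 1598 * xA - 82 * bA - 349 * bA * xA - 24 * bA ^ 2 - 98 * bA ^ 2 * xA), by linear_combination hc'' - hg23⟩)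
    have hle : {v : HeightOneSpectrum (𝓞 ↥ℚ⟮θ⟯) | v.asIdeal.ramificationIdxIn (𝓞 ↥(ℚ⟮θ⟯ ⊔ (CyclotomicZp.zpExtension 2).layer 1)) ≠ 1}.ncard ≤ 1 :=
      (Set.ncard_le_ncard hsub (Set.toFinite _)).trans (by rw [Set.ncard_singleton])
    calc 2 ^ {v : HeightOneSpectrum (𝓞 ↥ℚ⟮θ⟯) | v.asIdeal.ramificationIdxIn (𝓞 ↥(ℚ⟮θ⟯ ⊔ (CyclotomicZp.zpExtension 2).layer 1)) ≠ 1}.ncard ∣ 2 ^ 1 := pow_dvd_pow 2 hle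
      _ = 2 := by norm_num
  exact AmbiguousClass.odd_classNumber_of_quadratic_of_isTotallyReal_of_prod_ramificationIdxIn_dvd_two hdeg hram
    (odd_classNumber_adjoin_d6728p hθ)

end Summit.BirchSwinnertonDyer.BirchSwinnertonDyer.Theorems.AddKatoTwo

end
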